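import Summits.QuantumFields.YangMills.Theorems.BalabanUVNodesN12RootTransporterAtRecord
import Literature.MathematicalPhysics.QuantumFieldTheory.Balaban1983to89.B15Prop1GaugeLetterLocOfForestPackage
import HarnessLib

/-!
# BalabanUVNodes ∕ N12 — THE LOCALISED GAUGE LETTER (σ)_N AT THE ENDPOINT's OBJECTS, FOREST-FREE AND `hT`-FREE: the rooted tower forest of `𝐁_k(Z)` (p635000), the graded root-transporter
# letter from the root chains (this lineage) and dag-n12-w6's assembled producer `B15Prop1GaugeLetterLocOfForestPackage` (p640962) composed BY NAME — what stays displayed is the minimiser, the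
# region datum, the `N`-geometry, ONE graded root-free plaquette letter for `U₀`, the plaquette letter on the iterated averages near member segments, the datum letter, and no-wrapping numerics

Cell `pub-ymgap` (HUMAN RULINGS D-0062 ∕ D-0149), WIDTH SEAT `pub-ymgap-dag-n12-w3` g4 (node N12 = [B15]; key K1⁹ `stmt-QuantumFields-27364` (KEY MAP v2), `--kind proof --supports … --as
helper`; count-neutral; «w3 takes the (σ)_N capstone», dag-n12-w6 g2's offer, cell bus 2026-08-28).  THEOREMS ONLY (0 `def`, 0 `instance`, 0 `sorry`); composition BY NAME of
`N12TowerForestRootsBj.exists_towerForest_rooted_Bj` (the forest: (F2), walks, per-level (TOWER)(LEN)(DISP)(ROOTBLK), (Cov), (CENTRE)), `N12RootTransporterAtRecord.rootTransporter_atRecord_graded_of_plaqSmall`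
(`hT`, graded, plaquette edition) and dag-n12-w6's `B15Prop1GaugeLetterLocOfForestPackage.exists_gaugeLetterLoc_atRecord_of_forestPackage` (the (σ)_N producer of record).

WHAT IS CHOSEN INSIDE (LOCATED-GRADING, dag-n12-w6 ∕ dag-n12-c 2026-08-28): per-site word budgets `ℓs x := ℓ_{J(x)} = Σ_{i ≤ J(x)} (d(Lⁱ−1)∕2 + 1)` (`J(x)` = the `Γ`-level of `x`, (LEN) at that
rooted level), per-bond transporter budgets `ℓb b := m·L^{min(J(b₋)+1, k)}`, `m = 3·d·(L−1)∕2 + 5` (the graded root chains), caps `ℓ_k`, `m·L^k` for no-wrapping and the uniform tolerance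
`max ρn (((2ℓ_k + 1 + m·L^k)²∕4)·εP + m·θ_k + m·δ₁)`.  The graded plaquette letter is displayed in LEVEL FORM (boxes around `b₋` of radius `2·max ℓ_J ℓ_{J′} + 1 + m·L^{min(J+1,k)} + ℓ_J` for
the levels `J, J′` of the two ends) — root-free and forest-free.

HONEST FRAMING.  Composition by name; the minimiser ([15] Thm 1 ∕ the lane's (E)), the region datum, every plaquette estimate ((1.7)∕(2.14) for `U₀`, [Balaban1985Averaging] Prop. 1–2 for the
iterated averages), the datum letter and the numerics stay HYPOTHESES; nothing of Bałaban's is asserted; count-neutral; N12 NOT discharged; K1⁹ NOT closed; counts unmoved (typed 28∕28 ·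
discharged 5∕27); one finite 𝕋⁴ programme at fixed ε — R4 closes the conditional rung `BalabanLadder.UV` only; the Yang–Mills mass gap (Clay) is NOT proved by any of this; nothing continuum ∕ ℝ⁴ ∕ OS.
-/

noncomputable section

open scoped Matrix.Norms.L2Operator BigOperators

namespace Summit.QuantumFields.YangMills.BalabanUVNodes.N12GaugeLetterLocAtRecord

open Literature.MathematicalPhysics.QuantumFieldTheory.Balaban1983to89
open T4Continuum GaugeField B15DeterminingSets BlockAveraging
open T4CubeChartGnomonic (SU2)
open B16Sect1Backgrounds (toMS)
open T4AxialGaugeSmallField (boxPlaqs)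
open B14.Eq213MaximalDomains (side)
open B14.Eq213DetSet (Bj maxDomT)
open B14.Eq216Concrete (inputs)
open B14.Eq22Determines (blockIter)
open B5Eq118OneStroke (iterBlockOf)
open ExpMeanLog (deltaSU)
open Literature.MathematicalPhysics.QuantumFieldTheory.BalabanImbrieJaffe1984to88.BIJ85Eq453GaugeField (qsstarGIter0)
open B15Prop1GaugeLetterLocOfForestPackage (exists_gaugeLetterLoc_atRecord_of_forestPackage)
open Summit.QuantumFields.YangMills.BalabanUVNodes.N12TowerForestRootsBj (exists_towerForest_rooted_Bj)
open Summit.QuantumFields.YangMills.BalabanUVNodes.N12RootTransporterBj (theta_mono_of_nonneg)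
open Summit.QuantumFields.YangMills.BalabanUVNodes.N12RootTransporterAtRecord (rootTransporter_atRecord_graded_of_plaqSmall)

/-- ★★★ **THE LOCALISED GAUGE LETTER (σ)_N AT THE RECORD, FOREST-FREE AND `hT`-FREE.**  Objects of the endpoint: torus `F.P Kt`, numerics `ν` (`2 ≤ ν.M₁`, cover divisibility at level `k`),
`1 ≤ k ≤ m + K`, `Ω₁(Z) = maxDomT ν.M₁ Z 1`, `𝐁_k(Z)`; a `k`-field `W` that is `ρn`-near `1` on a bond set `𝒞` generating the data `M˙(Q_k^{s*}W)`; a (2.12) minimiser `U₀` in NODE 00's class; the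
neighbourhood `N` with dag-n12-w6's geometry letters `hGN`, `hN1`.  DISPLAYED ESTIMATES: ONE graded root-free plaquette letter for `U₀` (`PlaqSmallOn S εP U₀`, boxes in LEVEL FORM around the
sources of the bonds of `Ω₁(Z)` inside `S`); the plaquette letter `a_j` on the iterated averages `M^j(U₀)` near the member segments with budgets `θ` (`0 ≤ θ_0`, `6·(((d+2)L)²∕4)·a_j + L·θ_j ≤ θ_{j+1}`,
`(((d+2)L)²∕4)·a_j < δ_{SU(2)}`); the datum letter `hWj` (`0 ≤ δ₁`); no wrapping `2ℓ_k + 1 + m·L^k < sitesPerDir 0`.  CONCLUSION (dag-n12-w6's (σ)_N of record): a gauge `σ` with the root letter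
`hu` on `𝐁_k(Z)`, and `‖↑((U₀^σ) b) − 1‖ ≤ max ρn (((2ℓ_k+1+m·L^k)²∕4)·εP + m·θ_k + m·δ₁)` on the four bonds of every `Ω₁(Z)`-touching plaquette and on every bond of `inputs 𝐁_k(Z) ∩ N`
(`ℓ_k = Σ_{i≤k}(d(Lⁱ−1)∕2+1)`, `m = 3·d·(L−1)∕2 + 5`).  Inside: the rooted tower forest (p635000), graded budgets, the graded root-transporter letter (this lineage), the producer p640962.
[cite: Balaban1985Variational, (3)–(4) p.278, Thm 1 (8) p.279, (16)–(18) p.280; Balaban1985RegularSpaces, (1.7) p.77, (1.19) p.79; Balaban1988Convergent, (2.2) p.255, (2.12)–(2.13) pp.256–257, (2.16) p.257; Balaban1987RG1, (0.4) p.253] -/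
theorem exists_gaugeLetterLoc_atRecord {F : T4Family} (ν : Node00.Stage7Numerics) (Kt : ℕ) {k : ℕ} (hk0 : 0 < k) (hk : k ≤ (F.P Kt).m + (F.P Kt).K)
    (hM2 : 2 ≤ ν.M₁) (hdiv : side (F.P Kt).L ν.M₁ k ∣ (F.P Kt).sitesPerDir 0) (Z : Set (Site (F.P Kt) 0))
    -- no wrapping, at the caps `ℓ_k`, `m·L^k`
    (hN : 2 * (∑ i ∈ Finset.range (k + 1), ((F.P Kt).d * (((F.P Kt).L ^ i - 1) / 2) + 1)) + 1 +
      (3 * ((F.P Kt).d * (((F.P Kt).L - 1) / 2)) + 5) * (F.P Kt).L ^ k < (F.P Kt).sitesPerDir 0)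
    -- the region-normalised datum and the minimiser
    {ρn : ℝ} (hρn : 0 ≤ ρn)
    (W : GaugeField (F.P Kt) k SU2) (𝒞 : Set (PBond (F.P Kt) k)) (hD : ∀ c ∈ 𝒞, dist1 (W c) ≤ ρn)
    {U₀ : GaugeField (F.P Kt) 0 SU2}
    (hmin : IsMinimizer (Node00.avOfRecord F 2 Kt) (Node00.regMSCoPOfRecord F 2 ν Kt k (maxDomT ν.M₁ Z)) (Bj ν.M₁ Z k)
      (avgFamily (Node00.avOfRecord F 2 Kt) (qsstarGIter0 k W)) U₀)
    -- geometry of the neighbourhood (dag-n12-w6's letters, verbatim)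
    (N : Set (PBond (F.P Kt) 0))
    (hGN : ∀ b ∈ N, (b.src ∉ maxDomT ν.M₁ Z 1 ∨ b.tgt ∉ maxDomT ν.M₁ Z 1) → blockIter k b.tgt ≠ blockIter k b.src →
      (⟨blockIter k b.src, b.dir⟩ : PBond (F.P Kt) k) ∈ 𝒞)
    (hN1 : ∀ p : Plaq (F.P Kt) 0, ((⟨p.src, p.μ⟩ : PBond (F.P Kt) 0) ∈ {b : PBond (F.P Kt) 0 | b.src ∈ maxDomT ν.M₁ Z 1} ∨
        (⟨p.src.shift p.μ, p.ν⟩ : PBond (F.P Kt) 0) ∈ {b : PBond (F.P Kt) 0 | b.src ∈ maxDomT ν.M₁ Z 1} ∨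
        (⟨p.src.shift p.ν, p.μ⟩ : PBond (F.P Kt) 0) ∈ {b : PBond (F.P Kt) 0 | b.src ∈ maxDomT ν.M₁ Z 1} ∨
        (⟨p.src, p.ν⟩ : PBond (F.P Kt) 0) ∈ {b : PBond (F.P Kt) 0 | b.src ∈ maxDomT ν.M₁ Z 1}) →
      (⟨p.src, p.μ⟩ : PBond (F.P Kt) 0) ∈ N ∧ (⟨p.src.shift p.μ, p.ν⟩ : PBond (F.P Kt) 0) ∈ N ∧
        (⟨p.src.shift p.ν, p.μ⟩ : PBond (F.P Kt) 0) ∈ N ∧ (⟨p.src, p.ν⟩ : PBond (F.P Kt) 0) ∈ N)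
    -- DISPLAYED: ONE graded root-free plaquette letter for the minimiser, LEVEL FORM
    {S : Set (Plaq (F.P Kt) 0)} {εP : ℝ} (hεP : 0 ≤ εP) (hP : PlaqSmallOn S εP U₀)
    (hSΩ : ∀ b : PBond (F.P Kt) 0, b.src ∈ maxDomT ν.M₁ Z 1 → b.tgt ∈ maxDomT ν.M₁ Z 1 →
      ∀ J J' : ℕ, iterBlockOf J b.src ∈ (Bj ν.M₁ Z k : DetSet (F.P Kt)) J → iterBlockOf J' b.tgt ∈ (Bj ν.M₁ Z k : DetSet (F.P Kt)) J' →
      (boxPlaqs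
          (fun κ => ((b.src κ).val : ℤ) -
            (((2 * max (∑ i ∈ Finset.range (J + 1), ((F.P Kt).d * (((F.P Kt).L ^ i - 1) / 2) + 1))
                  (∑ i ∈ Finset.range (J' + 1), ((F.P Kt).d * (((F.P Kt).L ^ i - 1) / 2) + 1)) + 1 +
                (3 * ((F.P Kt).d * (((F.P Kt).L - 1) / 2)) + 5) * (F.P Kt).L ^ min (J + 1) k) +
              ∑ i ∈ Finset.range (J + 1), ((F.P Kt).d * (((F.P Kt).L ^ i - 1) / 2) + 1) : ℕ) : ℤ))
          (fun κ => ((b.src κ).val : ℤ) +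
            (((2 * max (∑ i ∈ Finset.range (J + 1), ((F.P Kt).d * (((F.P Kt).L ^ i - 1) / 2) + 1))
                  (∑ i ∈ Finset.range (J' + 1), ((F.P Kt).d * (((F.P Kt).L ^ i - 1) / 2) + 1)) + 1 +
                (3 * ((F.P Kt).d * (((F.P Kt).L - 1) / 2)) + 5) * (F.P Kt).L ^ min (J + 1) k) +
              ∑ i ∈ Finset.range (J + 1), ((F.P Kt).d * (((F.P Kt).L ^ i - 1) / 2) + 1) : ℕ) : ℤ) + 2) : Set (Plaq (F.P Kt) 0)) ⊆ S)
    -- DISPLAYED: the plaquette letter on the iterated averages near the member segments, with its budgets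
    (a θ : ℕ → ℝ) (hθ0 : 0 ≤ θ 0) (ha0 : ∀ j, 0 ≤ a j)
    (haN : ∀ j < k, (((((F.P Kt).d + 2) * (F.P Kt).L : ℕ) : ℝ) ^ 2 / 4) * a j < deltaSU (Fin 2))
    (hθ : ∀ j, 6 * ((((((F.P Kt).d + 2) * (F.P Kt).L : ℕ) : ℝ) ^ 2 / 4) * a j) + (F.P Kt).L * θ j ≤ θ (j + 1))
    (ha : ∀ i ≤ k, ∀ c ∈ bondsOf ((Bj ν.M₁ Z k : DetSet (F.P Kt)) i), ∀ j < i, ∀ c' : PBond (F.P Kt) (j + 1), c'.dir = c.dir →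
      (∃ s < (F.P Kt).L ^ i, embIter (j + 1) c'.src = (fun z : Site (F.P Kt) 0 => z.shift c.dir)^[s] (embIter i c.src)) →
      ∀ q : Plaq (F.P Kt) j, (blockOf q.src = c'.src.unshift c'.dir ∨ blockOf q.src = c'.src ∨ blockOf q.src = c'.tgt) →
        dist1 (GaugeField.plaqHol (avgFamily (Node00.avOfRecord F 2 Kt) U₀ j) q) < a j)
    -- DISPLAYED: the datum letter at the members (levels `≤ k`)
    {δ₁ : ℝ} (hδ0 : 0 ≤ δ₁) (hWj : ∀ i ≤ k, ∀ c ∈ bondsOf ((Bj ν.M₁ Z k : DetSet (F.P Kt)) i), dist1 (avgFamily (Node00.avOfRecord F 2 Kt) (qsstarGIter0 k W) i c) ≤ δ₁) :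
    ∃ σ : GaugeTransf (F.P Kt) 0 SU2,
      (∀ j, j ≤ k → ∀ b ∈ bondsOf (Bj ν.M₁ Z k j), toMS σ j b.src = 1 ∧ toMS σ j b.tgt = 1) ∧
        (∀ p : Plaq (F.P Kt) 0, ((⟨p.src, p.μ⟩ : PBond (F.P Kt) 0) ∈ {b : PBond (F.P Kt) 0 | b.src ∈ maxDomT ν.M₁ Z 1} ∨
            (⟨p.src.shift p.μ, p.ν⟩ : PBond (F.P Kt) 0) ∈ {b : PBond (F.P Kt) 0 | b.src ∈ maxDomT ν.M₁ Z 1} ∨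
            (⟨p.src.shift p.ν, p.μ⟩ : PBond (F.P Kt) 0) ∈ {b : PBond (F.P Kt) 0 | b.src ∈ maxDomT ν.M₁ Z 1} ∨
            (⟨p.src, p.ν⟩ : PBond (F.P Kt) 0) ∈ {b : PBond (F.P Kt) 0 | b.src ∈ maxDomT ν.M₁ Z 1}) →
          ‖((gaugeAct σ U₀ ⟨p.src, p.μ⟩ : SU2) : Matrix (Fin 2) (Fin 2) ℂ) - 1‖ ≤
              max ρn ((((2 * (∑ i ∈ Finset.range (k + 1), ((F.P Kt).d * (((F.P Kt).L ^ i - 1) / 2) + 1)) + 1 +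
                  (3 * ((F.P Kt).d * (((F.P Kt).L - 1) / 2)) + 5) * (F.P Kt).L ^ k : ℕ) : ℝ)) ^ 2 / 4 * εP +
                ((3 * ((F.P Kt).d * (((F.P Kt).L - 1) / 2)) + 5 : ℕ) : ℝ) * θ k + ((3 * ((F.P Kt).d * (((F.P Kt).L - 1) / 2)) + 5 : ℕ) : ℝ) * δ₁) ∧
            ‖((gaugeAct σ U₀ ⟨p.src.shift p.μ, p.ν⟩ : SU2) : Matrix (Fin 2) (Fin 2) ℂ) - 1‖ ≤
              max ρn ((((2 * (∑ i ∈ Finset.range (k + 1), ((F.P Kt).d * (((F.P Kt).L ^ i - 1) / 2) + 1)) + 1 +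
                  (3 * ((F.P Kt).d * (((F.P Kt).L - 1) / 2)) + 5) * (F.P Kt).L ^ k : ℕ) : ℝ)) ^ 2 / 4 * εP +
                ((3 * ((F.P Kt).d * (((F.P Kt).L - 1) / 2)) + 5 : ℕ) : ℝ) * θ k + ((3 * ((F.P Kt).d * (((F.P Kt).L - 1) / 2)) + 5 : ℕ) : ℝ) * δ₁) ∧
            ‖((gaugeAct σ U₀ ⟨p.src.shift p.ν, p.μ⟩ : SU2) : Matrix (Fin 2) (Fin 2) ℂ) - 1‖ ≤
              max ρn ((((2 * (∑ i ∈ Finset.range (k + 1), ((F.P Kt).d * (((F.P Kt).L ^ i - 1) / 2) + 1)) + 1 +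
                  (3 * ((F.P Kt).d * (((F.P Kt).L - 1) / 2)) + 5) * (F.P Kt).L ^ k : ℕ) : ℝ)) ^ 2 / 4 * εP +
                ((3 * ((F.P Kt).d * (((F.P Kt).L - 1) / 2)) + 5 : ℕ) : ℝ) * θ k + ((3 * ((F.P Kt).d * (((F.P Kt).L - 1) / 2)) + 5 : ℕ) : ℝ) * δ₁) ∧
            ‖((gaugeAct σ U₀ ⟨p.src, p.ν⟩ : SU2) : Matrix (Fin 2) (Fin 2) ℂ) - 1‖ ≤
              max ρn ((((2 * (∑ i ∈ Finset.range (k + 1), ((F.P Kt).d * (((F.P Kt).L ^ i - 1) / 2) + 1)) + 1 +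
                  (3 * ((F.P Kt).d * (((F.P Kt).L - 1) / 2)) + 5) * (F.P Kt).L ^ k : ℕ) : ℝ)) ^ 2 / 4 * εP +
                ((3 * ((F.P Kt).d * (((F.P Kt).L - 1) / 2)) + 5 : ℕ) : ℝ) * θ k + ((3 * ((F.P Kt).d * (((F.P Kt).L - 1) / 2)) + 5 : ℕ) : ℝ) * δ₁)) ∧
        (∀ b ∈ inputs (Bj ν.M₁ Z k), b ∈ N →
          ‖((gaugeAct σ U₀ b : SU2) : Matrix (Fin 2) (Fin 2) ℂ) - 1‖ ≤
              max ρn ((((2 * (∑ i ∈ Finset.range (k + 1), ((F.P Kt).d * (((F.P Kt).L ^ i - 1) / 2) + 1)) + 1 +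
                  (3 * ((F.P Kt).d * (((F.P Kt).L - 1) / 2)) + 5) * (F.P Kt).L ^ k : ℕ) : ℝ)) ^ 2 / 4 * εP +
                ((3 * ((F.P Kt).d * (((F.P Kt).L - 1) / 2)) + 5 : ℕ) : ℝ) * θ k + ((3 * ((F.P Kt).d * (((F.P Kt).L - 1) / 2)) + 5 : ℕ) : ℝ) * δ₁)) := by
  classical
  have hk1 : 1 ≤ k := hk0
  have hM : 1 ≤ ν.M₁ := by omega
  -- the rooted tower forest of `𝐁_k(Z)` (p635000)
  obtain ⟨path, root, -, hF2, -, -, hw, hlevel, hcov, hcentre⟩ :=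
    exists_towerForest_rooted_Bj (P := F.P Kt) (M₁ := ν.M₁) (Z := Z) hk hk1 hM2 hdiv
  -- the `Γ`-level of a site (a choice; unique anyway) and the graded budgets
  have hJ : ∀ x : Site (F.P Kt) 0, Classical.choose (hcov x) ≤ k ∧ iterBlockOf (Classical.choose (hcov x)) x ∈ (Bj ν.M₁ Z k : DetSet (F.P Kt)) (Classical.choose (hcov x)) :=
    fun x => Classical.choose_spec (hcov x)
  set ℓs : Site (F.P Kt) 0 → ℕ := fun x => ∑ i ∈ Finset.range (Classical.choose (hcov x) + 1), ((F.P Kt).d * (((F.P Kt).L ^ i - 1) / 2) + 1) with hℓs_def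
  set ℓb : PBond (F.P Kt) 0 → ℕ := fun b => (3 * ((F.P Kt).d * (((F.P Kt).L - 1) / 2)) + 5) * (F.P Kt).L ^ min (Classical.choose (hcov b.src) + 1) k with hℓb_def
  -- the centre of the `Γ`-level block is a root point, so (LEN) at that level bounds the word
  have hℓs : ∀ x ∈ maxDomT ν.M₁ Z 1, (path x).length ≤ ℓs x := fun x _ => by
    have hmemR : embIter (Classical.choose (hcov x)) (iterBlockOf (Classical.choose (hcov x)) x) ∈
        {z : Site (F.P Kt) 0 | ∃ j, j ≤ k ∧ ∃ c ∈ bondsOf ((Bj ν.M₁ Z k : DetSet (F.P Kt)) j), (z = embIter j c.src ∨ z = embIter j c.tgt)} :=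
      ⟨_, (hJ x).1, ⟨iterBlockOf (Classical.choose (hcov x)) x, ⟨0, (F.P Kt).hd⟩⟩, Or.inl (hJ x).2, Or.inl rfl⟩
    exact (hlevel x _ (hJ x).1 hmemR).2.1
  have hcapS : ∀ x ∈ maxDomT ν.M₁ Z 1, ℓs x ≤ ∑ i ∈ Finset.range (k + 1), ((F.P Kt).d * (((F.P Kt).L ^ i - 1) / 2) + 1) := fun x _ => by
    show (∑ i ∈ Finset.range (Classical.choose (hcov x) + 1), ((F.P Kt).d * (((F.P Kt).L ^ i - 1) / 2) + 1)) ≤ _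
    apply Finset.sum_le_sum_of_subset
    intro i hi
    have hJx := (hJ x).1
    simp only [Finset.mem_range] at hi ⊢
    omega
  have hcapB : ∀ b : PBond (F.P Kt) 0, b.src ∈ maxDomT ν.M₁ Z 1 → b.tgt ∈ maxDomT ν.M₁ Z 1 →
      ℓb b ≤ (3 * ((F.P Kt).d * (((F.P Kt).L - 1) / 2)) + 5) * (F.P Kt).L ^ k := fun b _ _ =>
    Nat.mul_le_mul_left _ (Nat.pow_le_pow_right (F.P Kt).L_pos (min_le_right _ _))
  -- the graded root-transporter letter `hT` (this lineage), then uniform error budgets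
  have hκ0 : ∀ j, 0 ≤ 6 * ((((((F.P Kt).d + 2) * (F.P Kt).L : ℕ) : ℝ) ^ 2 / 4) * a j) := fun j => by
    have h1 : (0 : ℝ) ≤ (((((F.P Kt).d + 2) * (F.P Kt).L : ℕ) : ℝ) ^ 2 / 4) := by positivity
    have := mul_nonneg h1 (ha0 j)
    linarith
  have hθmono : ∀ i j, i ≤ j → θ i ≤ θ j := fun i j hij => (theta_mono_of_nonneg _ θ hθ0 hκ0 hθ hij).2
  have hθk0 : 0 ≤ θ k := hθ0.trans (hθmono 0 k (Nat.zero_le k))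
  have hm0 : (0 : ℝ) ≤ ((3 * ((F.P Kt).d * (((F.P Kt).L - 1) / 2)) + 5 : ℕ) : ℝ) := Nat.cast_nonneg _
  have hT : ∀ b : PBond (F.P Kt) 0, b.src ∈ maxDomT ν.M₁ Z 1 → b.tgt ∈ maxDomT ν.M₁ Z 1 → root b.src ≠ root b.tgt →
      ∃ (Ωw : List (Letter (F.P Kt).d)) (g : SU2), walkEnd (root b.src) Ωw = root b.tgt ∧ Ωw.length ≤ ℓb b ∧
        dist1 (holAt U₀ (walk (root b.src) Ωw) * g⁻¹) ≤ ((3 * ((F.P Kt).d * (((F.P Kt).L - 1) / 2)) + 5 : ℕ) : ℝ) * θ k ∧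
        dist1 g ≤ ((3 * ((F.P Kt).d * (((F.P Kt).L - 1) / 2)) + 5 : ℕ) : ℝ) * δ₁ := by
    intro b hbs hbt hne
    obtain ⟨Ωw, g, hwe, hl, hH, hg⟩ := rootTransporter_atRecord_graded_of_plaqSmall ν Kt hk1 hk hM2 hdiv Z root hcentre W hmin a θ hθ0 ha0 haN hθ ha hWj
      b hbs hbt hne _ (hJ b.src).2
    refine ⟨Ωw, g, hwe, hl, hH.trans (mul_le_mul_of_nonneg_left (hθmono _ _ (min_le_right _ _)) hm0), hg⟩
  -- the graded plaquette letter in dag-n12-w6's `ℓs`∕`ℓb` form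
  have hSΩ' : ∀ b : PBond (F.P Kt) 0, b.src ∈ maxDomT ν.M₁ Z 1 → b.tgt ∈ maxDomT ν.M₁ Z 1 →
      (boxPlaqs (fun κ => ((b.src κ).val : ℤ) - (((2 * max (ℓs b.src) (ℓs b.tgt) + 1 + ℓb b) + ℓs b.src : ℕ) : ℤ))
          (fun κ => ((b.src κ).val : ℤ) + (((2 * max (ℓs b.src) (ℓs b.tgt) + 1 + ℓb b) + ℓs b.src : ℕ) : ℤ) + 2) : Set (Plaq (F.P Kt) 0)) ⊆ S :=
    fun b hbs hbt => hSΩ b hbs hbt _ _ (hJ b.src).2 (hJ b.tgt).2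
  exact exists_gaugeLetterLoc_atRecord_of_forestPackage ν Kt hk0 hk Z path root hF2 (fun x => ⟨(hw x).2.1, (hw x).2.2⟩) hlevel hcov ℓs hℓs ℓb hcapS hcapB hN hρn W 𝒞 hD hmin N hGN hN1 hεP hP hSΩ'
    (mul_nonneg hm0 hθk0) (mul_nonneg hm0 hδ0) hT

end Summit.QuantumFields.YangMills.BalabanUVNodes.N12GaugeLetterLocAtRecord

end
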